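import Summits.HodgeConjecture.HodgeConjecture.Theorems.F0P3ArchTokenSeam
import Summits.HodgeConjecture.HodgeConjecture.Theorems.F0P3HolGenIsometry
import Summits.HodgeConjecture.HodgeConjecture.Theorems.F0P3bStubT3aUnitaryAlongPOfHermitian
import HarnessLib

/-!
# Crux `H413` — ENGINE-side archimedean SEAM, part 2: the UNITARY representative `gen(Φ)` of the tokens of a holomorphic-type `P`,
# and «every token of a holomorphic `P` ≅ every irreducible unitary cohomological module of type `+1`» (P3b's `J⁺` included)

Floor-0 programme P3 «U3-mult», seat F0P3-p01 (g5); crux item stmt-HodgeConjecture-24833 (`HCCMUnconditional.H413`); sequel of ★-pending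
`F0P3ArchTokenSeam` (§1–§3: tokens of one `P` are `(𝔤, K)`-equivalent and carry one sign).  F0P3-plan (g3) 05:04:52Z GO (O1) (b).
PROOF lane: no `def`, no `sorry`, no named fact asserted; `--supports stmt-HodgeConjecture-24833`.
HONEST LABEL: HC_CM is proved only modulo the printed citations until rung 0 closes.

§4 (compact CM datum `hdef`, `h2`).  `gen(Φ)` — the `(𝔤, K)`-submodule of `P.archModuleCM ι T hT` generated by the coordinate classes of a
non-zero holomorphic cotangent form `Φ ∈ P` (★ `F0P3HolGenIsometry`: irreducible, admissible, typed value map; restricted actions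
`(P.archRepKCM ι T hT).subrepresentation U hK`, `GKSubmodule.subLie … U h𝔤`):
* `exists_invariantHermitianForm_sub_cm` — the `L²` form is an invariant positive Hermitian form on any `𝔤`-stable `U` (★ `inner_archRepLieCM_sub`);
* **`isCohUnitaryIrrep_gen_cm`** — `gen(Φ)` is `IsCohUnitaryIrrep` (the currency of P3b's `ArchCohomologicalMembers` ∕ T6c; unitarity along `𝔭`
  via ★ T3a₄ `stubT3aUnitaryAlongPOfHermitian_holds`), and **`upqTypeClasses_gen_ne_bot_cm`** — it has a non-zero type-`(+1)` class (★ J2);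
* **`areGKEquivalent_token_gen_cm`** — every token of `P` is `(𝔤, K)`-equivalent to `gen(Φ)` (both ≅ the detecting module of F1a: the token as
  a quotient, ★-pending `F0P3ArchTokenSeam.areGKEquivalent_token_of_cogenerated`; `gen` as a submodule, Schur);
* **`token_areGKEquivalent_cohUnitaryIrrep_of_isHolCotangentAt_cpt`** — THE SEAM: every token of a holomorphic-type `P` is `(𝔤, K)`-equivalent to
  EVERY irreducible unitary cohomological module with a non-zero type-`(+1)` class (★ T6c `stub_T6c_degOneTypeRigid`), in particular to P3b's
  realised `J⁺` (★ X1 `F0P3bArchCohomologicalMembers.archCohomologicalMembers_holds`) — the «`IsHolCotangentAt` ⇒ `P_ι ≅ J^{(1,0)}`» half of the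
  T6∕T7 seam of ENGINE-INTERFACES §2 in token currency, the archimedean input of S2♭'s eventual in-house proof;
* `exists_cohUnitaryIrrep_token_of_isHolCotangentAt_cpt` — a token of `P` that is itself `IsCohUnitaryIrrep` with a type-`(+1)` class.

Elaboration notes (nested subtype `↥gen ⊆ archModuleCM ⊆ P.space ⊆ L²`): existentials are eliminated in term mode and ★ J2 is instantiated at
`V := ↥U` BEFORE being fed the value-map data (two-stage `have`); one-shot applications send the unifier through the `ℝ`-module instance paths
of `↥U` and time out at `whnf` under any budget (same phenomenon as in ★ `F0P3HolGenIsometry.exists_gkIso_gen_cm`).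

References: [Rogawski1990] Prop. 15.2.1 (b), §12.3 p. 178; [BorelWallach2000] 0 §2.5, II §4.1–4.2, VI Thm. 4.11; [FlathCorvallis1979] Thm. 3–4;
[HarishChandra1953] Thms. 4–6; [BourbakiAlgebreVIII2012] VIII §4 n°1–2; [KnappVogan1995] App. A (A.17).
-/

set_option autoImplicit false
-- the mandated namespace repeats `HodgeConjecture.HodgeConjecture`, as in every `Theorems/*.lean` of this sub-problem
set_option linter.dupNamespace false

-- Mathlib idiom (as in ★ `GKModules`, the `Upq*` files and every `(𝔤, K)` file of this sub-problem): commutator bracket on `Module.End`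
attribute [local instance 100] LieRing.ofAssociativeRing

noncomputable section

namespace Summit.HodgeConjecture.HodgeConjecture.Cruxes.H413.F0P3ArchTokenUnitary

open NumberField NumberField.InfinitePlace MeasureTheory
open scoped Matrix MatrixGroups ComplexOrder InnerProductSpace
open Literature.NumberTheory.Automorphic Literature.NumberTheory.Automorphic.UnitaryGroup
open Literature.NumberTheory.Automorphic.UnitaryGroup.CotangentForms
open Literature.RepresentationTheory.BorelWallach2000
open Literature.RepresentationTheory.KonnoKonno2007 Literature.RepresentationTheory.KonnoKonno2007.RealDualPair
open Literature.RepresentationTheory.KonnoKonno2007.RealDualPair.UForm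
open Summit.HodgeConjecture.HodgeConjecture.Cruxes.H413.F0P3ArchIsotypyCM
open Summit.HodgeConjecture.HodgeConjecture.Cruxes.H413.F0P3bArchDegOnePackage
open Summit.HodgeConjecture.HodgeConjecture.Cruxes.H413.F0P3SLayerFoldShapes
open Summit.HodgeConjecture.HodgeConjecture.Cruxes.H413.F0P3ArchTokenSeam
open Summit.HodgeConjecture.HodgeConjecture.Cruxes.H413.F0P3HolGenIsometry
open Summit.HodgeConjecture.HodgeConjecture.Cruxes.H413.F0P3PNullMapIsCocycle
open Summit.HodgeConjecture.HodgeConjecture.Cruxes.H413.F0P3bStubT3aUnitaryAlongPOfHermitian (stubT3aUnitaryAlongPOfHermitian_holds)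
open Summit.HodgeConjecture.HodgeConjecture.Cruxes.H413.F0P3CotangentFormValueMap (exists_vectors)
open Summit.HodgeConjecture.HodgeConjecture.Cruxes.H413.F0P3CotangentFormL2Span (memLp_toQuotFun_apply)
open Summit.HodgeConjecture.HodgeConjecture.Cruxes.H413.F0P3bPNullGeneration (gen)
open Summit.HodgeConjecture.HodgeConjecture.Cruxes.H413.F0P3HolProjectionReduction (compactSpace_automorphicQuotient_cm)

/-! ## §4 The UNITARY representative `gen(Φ)` and the seam to every irreducible unitary cohomological module of type `+1` -/

-- third-level subtype carrier `↥gen ⊆ archModuleCM ⊆ P.space ⊆ L²`: instance synthesis and the definitional unfolding of the restricted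
-- actions through the coercion layers need head-room (measured in ★ `F0P3HolGenIsometry`: fails at the defaults)
set_option synthInstance.maxHeartbeats 100000
set_option maxHeartbeats 1600000

variable {L : Type} [Field L] [NumberField L] [IsCMField L] (ι : L →+* ℂ) {H : Matrix (Fin 3) (Fin 3) L}
  (T : GL (Fin 3) ℂ) (hT : (T : Matrix (Fin 3) (Fin 3) ℂ)ᴴ * H.map ι * (T : Matrix (Fin 3) (Fin 3) ℂ) = Literature.Geometry.ComplexHyperbolic.BallModel.J)
  (hdef : ∀ τ' : L →+* ℂ, InfinitePlace.mk τ' ≠ InfinitePlace.mk ι → (H.map τ').PosDef) (h2 : 2 ≤ Module.finrank ℚ ↥(maximalRealSubfield L))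
  (μ : Measure (adelicGroupData (↥(maximalRealSubfield L)) L (IsCMField.complexConj L) 3 H).automorphicQuotient)
  [(adelicGroupData (↥(maximalRealSubfield L)) L (IsCMField.complexConj L) 3 H).IsAutomorphicMeasure μ]
  (P : DiscreteAutomorphicRep (adelicGroupData (↥(maximalRealSubfield L)) L (IsCMField.complexConj L) 3 H) μ)
  {Φ : (adelicGroupData (↥(maximalRealSubfield L)) L (IsCMField.complexConj L) 3 H).Adelic → (Fin 2 → ℂ)}
  (hΦ : Φ ∈ holCotForms (↥(maximalRealSubfield L)) L (IsCMField.complexConj L) 3 H (cmArchSection L ι H T hT) (cmCompactFactor L ι H T hT))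
  (v : Fin 2 → P.archModuleCM ι T hT)
  (hv : ∀ j : Fin 2, ∃ hm : MemLp (toQuotFun (adelicGroupData (↥(maximalRealSubfield L)) L (IsCMField.complexConj L) 3 H) fun x => Φ x j) 2 μ,
    (((v j : P.archModuleCM ι T hT) : P.space.toSubmodule) : (adelicGroupData (↥(maximalRealSubfield L)) L (IsCMField.complexConj L) 3 H).L2 μ) =
      hm.toLp _)

/-- **The `L²` form on a `𝔤`-stable subspace `U` of the archimedean module is an invariant positive Hermitian form** for the restricted
`𝔤`-action (★ `inner_archRepLieCM_sub`: `𝔤` acts by skew-Hermitian operators; positivity of the `L²` inner product), in the hypothesis shape of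
★ T3a₄ `stubT3aUnitaryAlongPOfHermitian_holds`. [cite: BorelWallach2000, 0 §2.5] -/
theorem exists_invariantHermitianForm_sub_cm {U : Submodule ℂ (P.archModuleCM ι T hT)}
    (h𝔤 : ∀ X : (uFormGroup (Fin 2) (Fin 1)).lie, U ≤ U.comap (P.archRepLieCM ι T hT X)) :
    ∃ B : ↥U →ₗ⋆[ℂ] ↥U →ₗ[ℂ] ℂ,
      (∀ x y, B x y = starRingEnd ℂ (B y x)) ∧ (∀ x, x ≠ 0 → 0 < (B x x).re) ∧
        ∀ (X : (uFormGroup (Fin 2) (Fin 1)).lie) (x y : ↥U),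
          B (GKSubmodule.subLie (uFormGroup (Fin 2) (Fin 1)) (P.archRepLieCM ι T hT) U h𝔤 X x) y =
            -B x (GKSubmodule.subLie (uFormGroup (Fin 2) (Fin 1)) (P.archRepLieCM ι T hT) U h𝔤 X y) := by
  -- the inclusion `U ↪ P.space` and the `L²` inner product pulled back along it
  let j : ↥U →ₗ[ℂ] P.space.toSubmodule := (P.archModuleCM ι T hT).subtype ∘ₗ U.subtype
  let B : ↥U →ₗ⋆[ℂ] ↥U →ₗ[ℂ] ℂ := ((innerₛₗ ℂ).comp j).compl₂ j
  have hB : ∀ x y : ↥U, B x y = ⟪((x : P.archModuleCM ι T hT) : P.space.toSubmodule),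
      ((y : P.archModuleCM ι T hT) : P.space.toSubmodule)⟫_ℂ := fun x y => rfl
  refine ⟨B, fun x y => ?_, fun x hx => ?_, fun X x y => ?_⟩
  · rw [hB, hB, Submodule.coe_inner, Submodule.coe_inner]
    exact (inner_conj_symm _ _).symm
  · rw [hB, Submodule.coe_inner]
    have hx' : ((((x : P.archModuleCM ι T hT) : P.space.toSubmodule)) :
        (adelicGroupData (↥(maximalRealSubfield L)) L (IsCMField.complexConj L) 3 H).L2 μ) ≠ 0 := fun h0 =>
      hx (Subtype.ext (Subtype.ext (Subtype.ext h0)))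
    exact (re_inner_self_pos (𝕜 := ℂ)).2 hx'
  · exact (hB _ _).trans ((eq_neg_of_add_eq_zero_left (inner_archRepLieCM_sub ι T hT P h𝔤 X x y)).trans
      (congrArg Neg.neg (hB _ _).symm))

include hdef h2 hΦ hv in
/-- **`gen(Φ)` IS AN IRREDUCIBLE UNITARY COHOMOLOGICAL MODULE** (`IsCohUnitaryIrrep`, the currency of P3b's `ArchCohomologicalMembers` ∕ T6c):
with `U = gen` of the null core `span {v₀, v₁}` of a non-zero holomorphic cotangent form `Φ ∈ P` and the restricted actions —
`IsGKModule` (★ `isGKModule_sub_cm`), irreducible (★ `isIrreducibleGK_gen_cm`), admissible (★ `isAdmissibleGK_gen_cm`), unitary along `𝔭 ⊕ ℝz₀`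
(★ T3a₄ `stubT3aUnitaryAlongPOfHermitian_holds` on `exists_invariantHermitianForm_sub_cm`). [cite: Rogawski1990, Prop. 15.2.1 (b)]
[cite: BorelWallach2000, 0 §2.5; II §4.1; VI Thm. 4.11] [cite: HarishChandra1953, Thms. 4–6] -/
theorem isCohUnitaryIrrep_gen_cm (hΦ0 : Φ ≠ 0) (U : Submodule ℂ (P.archModuleCM ι T hT))
    (hU : U = gen (P.archRepLieCM ι T hT) Complex.I (Submodule.span ℂ (Set.range v)))
    (hK : ∀ k : (uFormGroup (Fin 2) (Fin 1)).maximalCompact, U ≤ U.comap (P.archRepKCM ι T hT k))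
    (h𝔤 : ∀ X : (uFormGroup (Fin 2) (Fin 1)).lie, U ≤ U.comap (P.archRepLieCM ι T hT X)) :
    IsCohUnitaryIrrep (V := ↥U) ((P.archRepKCM ι T hT).subrepresentation U hK)
      (GKSubmodule.subLie (uFormGroup (Fin 2) (Fin 1)) (P.archRepLieCM ι T hT) U h𝔤) :=
  ⟨isGKModule_sub_cm ι T hT P hK h𝔤, isIrreducibleGK_gen_cm ι T hT hdef h2 μ P hΦ v hv hΦ0 U hU hK h𝔤,
    isAdmissibleGK_gen_cm ι T hT hdef h2 μ P hΦ v hv U hU hK,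
    stubT3aUnitaryAlongPOfHermitian_holds (Fin 2) (Fin 1) ↥U
      (GKSubmodule.subLie (uFormGroup (Fin 2) (Fin 1)) (P.archRepLieCM ι T hT) U h𝔤) (exists_invariantHermitianForm_sub_cm ι T hT μ P h𝔤)⟩

include hdef h2 hΦ hv in
/-- **`gen(Φ)` carries a non-zero degree-one class of type `+1`** (★ `exists_valueMap_gen_cm` = the value map of `Φ` co-restricted to `gen`,
then ★ J2 `typeClasses_ne_bot_of_linearMap`). [cite: BorelWallach2000, II §4.2; VI Thm. 4.11] [cite: Rogawski1990, Prop. 15.2.1 (b)] -/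
theorem upqTypeClasses_gen_ne_bot_cm (hΦ0 : Φ ≠ 0) (U : Submodule ℂ (P.archModuleCM ι T hT))
    (hU : U = gen (P.archRepLieCM ι T hT) Complex.I (Submodule.span ℂ (Set.range v)))
    (hK : ∀ k : (uFormGroup (Fin 2) (Fin 1)).maximalCompact, U ≤ U.comap (P.archRepKCM ι T hT k))
    (h𝔤 : ∀ X : (uFormGroup (Fin 2) (Fin 1)).lie, U ≤ U.comap (P.archRepLieCM ι T hT X)) :
    upqTypeClasses (V := ↥U) ((P.archRepKCM ι T hT).subrepresentation U hK)
        (GKSubmodule.subLie (uFormGroup (Fin 2) (Fin 1)) (P.archRepLieCM ι T hT) U h𝔤)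
        (isGKModule_sub_cm ι T hT P hK h𝔤).ad_compat 1 1 ≠ ⊥ := by
  -- Two-stage application on purpose: instantiate ★ J2 at `V := ↥U` FIRST (`key`), then feed the value-map data.  Elaborating the full
  -- application in one go (or against the goal) sends the unifier through the `ℝ`-module instance paths of the nested subtype `↥U` and times
  -- out at `whnf` under any budget; term-mode `.elim` for the same reason as in ★ `exists_gkIso_gen_cm`.
  refine (exists_valueMap_gen_cm ι T hT hdef h2 μ P hΦ v hv hΦ0 U hU hK h𝔤).elim fun φ hφ => ?_
  have hirr := isIrreducibleGK_gen_cm ι T hT hdef h2 μ P hΦ v hv hΦ0 U hU hK h𝔤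
  have key := typeClasses_ne_bot_of_linearMap (V := ↥U) ((P.archRepKCM ι T hT).subrepresentation U hK)
    (GKSubmodule.subLie (uFormGroup (Fin 2) (Fin 1)) (P.archRepLieCM ι T hT) U h𝔤) (isGKModule_sub_cm ι T hT P hK h𝔤).ad_compat
    hirr (δ := 1) (Or.inl rfl)
  have key' := key φ hφ.1 hφ.2.2.1 hφ.2.2.2.1 hφ.2.2.2.2.1 hφ.2.2.2.2.2.1 hφ.2.2.2.2.2.2
  exact key'

include hdef h2 hΦ hv in
/-- **Every token of `P ∋ Φ` is `(𝔤, K)`-equivalent to `gen(Φ)`**: the token as an irreducible QUOTIENT of the archimedean module is equivalent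
to the detecting module `M_det` of F1a (§2 `areGKEquivalent_token_of_cogenerated`), and so is `gen` — a non-zero vector of `gen` is detected by a
map `P.archModuleCM → M_det` whose restriction to `gen` is a non-zero `(𝔤, K)`-map between irreducibles (Schur, ★ `GKRing.areGKEquivalent_of_ne_zero_asModule`).
F1a for the holomorphic-type `P` is ★ in-house (`F0P3StubF1aHolHalf.archIsotypy_of_isHolCotangentAt`). [cite: FlathCorvallis1979, Thm. 3 and Thm. 4]
[cite: BourbakiAlgebreVIII2012, VIII §4 n°1–2] -/
theorem areGKEquivalent_token_gen_cm (hΦ0 : Φ ≠ 0) (hPΦ : P.ContainsForm Φ) (U : Submodule ℂ (P.archModuleCM ι T hT))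
    (hU : U = gen (P.archRepLieCM ι T hT) Complex.I (Submodule.span ℂ (Set.range v)))
    (hK : ∀ k : (uFormGroup (Fin 2) (Fin 1)).maximalCompact, U ≤ U.comap (P.archRepKCM ι T hT k))
    (h𝔤 : ∀ X : (uFormGroup (Fin 2) (Fin 1)).lie, U ≤ U.comap (P.archRepLieCM ι T hT X))
    {M : Type} [AddCommGroup M] [Module ℂ M]
    {σK : Representation ℂ (uFormGroup (Fin 2) (Fin 1)).maximalCompact M}
    {σ𝔤 : (uFormGroup (Fin 2) (Fin 1)).lie →ₗ⁅ℝ⁆ Module.End ℂ M}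
    (hirr : IsIrreducibleGK σK σ𝔤) (T₁ : P.archModuleCM ι T hT →ₗ[ℂ] M)
    (hT₁K : ∀ (k : (uFormGroup (Fin 2) (Fin 1)).maximalCompact) (w : P.archModuleCM ι T hT),
      T₁ (P.archRepKCM ι T hT k w) = σK k (T₁ w))
    (hT₁𝔤 : ∀ (X : (uFormGroup (Fin 2) (Fin 1)).lie) (w : P.archModuleCM ι T hT),
      T₁ (P.archRepLieCM ι T hT X w) = σ𝔤 X (T₁ w))
    (hT₁ : T₁ ≠ 0) :
    AreGKEquivalent σK σ𝔤 (V' := ↥U) ((P.archRepKCM ι T hT).subrepresentation U hK)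
      (GKSubmodule.subLie (uFormGroup (Fin 2) (Fin 1)) (P.archRepLieCM ι T hT) U h𝔤) := by
  have hP : P.IsHolCotangentAt (cmArchSection L ι H T hT) (cmCompactFactor L ι H T hT) := ⟨Φ, hΦ, hΦ0, hPΦ⟩
  have hF1a := F0P3StubF1aHolHalf.archIsotypy_of_isHolCotangentAt ι T hT hdef h2 μ P hP
  have hex := exists_detecting_irreducible ι T hT P hF1a
  obtain ⟨Md, i₁, i₂, σKd, σ𝔤d, -, hirrd, hadmd, hdet⟩ := hex
  have hirrU := isIrreducibleGK_gen_cm ι T hT hdef h2 μ P hΦ v hv hΦ0 U hU hK h𝔤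
  haveI : Nontrivial ↥U := hirrU.1
  -- `gen ≅ M_det`: restrict a detecting map of a non-zero vector of `gen` to `gen`
  have hU' : AreGKEquivalent (V := ↥U) ((P.archRepKCM ι T hT).subrepresentation U hK)
      (GKSubmodule.subLie (uFormGroup (Fin 2) (Fin 1)) (P.archRepLieCM ι T hT) U h𝔤) σKd σ𝔤d := by
    obtain ⟨x, hx⟩ := exists_ne (0 : ↥U)
    have hx' : (x : P.archModuleCM ι T hT) ≠ 0 := fun h => hx (Subtype.ext h)
    obtain ⟨φ, hφK, hφ𝔤, hφx⟩ := hdet _ hx'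
    refine GKRing.areGKEquivalent_of_ne_zero_asModule _ _ σKd σ𝔤d hirrU hirrd (φ ∘ₗ U.subtype)
      (fun k w => hφK k w) (fun X w => hφ𝔤 X w) fun h0 => hφx ?_
    have h := LinearMap.congr_fun h0 x
    rw [LinearMap.comp_apply, Submodule.subtype_apply, LinearMap.zero_apply] at h
    exact h
  -- the token `≅ M_det`
  have hM : AreGKEquivalent σK σ𝔤 σKd σ𝔤d :=
    areGKEquivalent_token_of_cogenerated ι T hT P hirrd hadmd hdet hirr T₁ hT₁K hT₁𝔤 hT₁
  exact hM.trans' hU'.symm'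

include hdef h2 in
/-- **THE SEAM — every token of a holomorphic-type `P` is `(𝔤, K)`-equivalent to EVERY irreducible unitary cohomological module with a
non-zero type-`(+1)` class**, in particular to P3b's realised `J⁺` (★ X1 `F0P3bArchCohomologicalMembers.archCohomologicalMembers_holds`):
the token ≅ `gen(Φ)` (`areGKEquivalent_token_gen_cm`), `gen(Φ)` is `IsCohUnitaryIrrep` of type `+1` (`isCohUnitaryIrrep_gen_cm`,
`upqTypeClasses_gen_ne_bot_cm`), and two such modules are equivalent (★ T6c `stub_T6c_degOneTypeRigid`).  Compact CM datum; no letter.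
This is the «`IsHolCotangentAt` ⇒ `P_ι ≅ J^{(1,0)}`» half of the T6∕T7 seam of ENGINE-INTERFACES §2, in token currency.
[cite: Rogawski1990, Prop. 15.2.1 (b); §12.3 p. 178] [cite: BorelWallach2000, VI Thm. 4.11] [cite: FlathCorvallis1979, Thm. 3 and Thm. 4] -/
theorem token_areGKEquivalent_cohUnitaryIrrep_of_isHolCotangentAt_cpt
    (hP : P.IsHolCotangentAt (cmArchSection L ι H T hT) (cmCompactFactor L ι H T hT))
    {M : Type} [AddCommGroup M] [Module ℂ M]
    {σK : Representation ℂ (uFormGroup (Fin 2) (Fin 1)).maximalCompact M}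
    {σ𝔤 : (uFormGroup (Fin 2) (Fin 1)).lie →ₗ⁅ℝ⁆ Module.End ℂ M}
    (hirr : IsIrreducibleGK σK σ𝔤) (T₁ : P.archModuleCM ι T hT →ₗ[ℂ] M)
    (hT₁K : ∀ (k : (uFormGroup (Fin 2) (Fin 1)).maximalCompact) (w : P.archModuleCM ι T hT),
      T₁ (P.archRepKCM ι T hT k w) = σK k (T₁ w))
    (hT₁𝔤 : ∀ (X : (uFormGroup (Fin 2) (Fin 1)).lie) (w : P.archModuleCM ι T hT),
      T₁ (P.archRepLieCM ι T hT X w) = σ𝔤 X (T₁ w))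
    (hT₁ : T₁ ≠ 0)
    (W : Type) [AddCommGroup W] [Module ℂ W] (ρK : Representation ℂ (uFormGroup (Fin 2) (Fin 1)).maximalCompact W)
    (ρ𝔤 : (uFormGroup (Fin 2) (Fin 1)).lie →ₗ⁅ℝ⁆ Module.End ℂ W) (hW : IsCohUnitaryIrrep ρK ρ𝔤)
    (hWt : upqTypeClasses ρK ρ𝔤 hW.gk.ad_compat 1 1 ≠ ⊥) : AreGKEquivalent σK σ𝔤 ρK ρ𝔤 := by
  haveI := compactSpace_automorphicQuotient_cm hdef h2 (L := L) (ι := ι) (H := H)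
  obtain ⟨Φ, hΦ, hΦ0, hPΦ⟩ := hP
  have hPj : ∀ j : Fin 2, (memLp_toQuotFun_apply ι T hT (μ := μ) hΦ j).toLp _ ∈ P.space.toSubmodule :=
    fun j => (hPΦ j).elim fun _ h => h
  have hvex := exists_vectors ι T hT P hΦ hPj
  obtain ⟨v, hv⟩ := hvex
  have hv' : ∀ j : Fin 2, ∃ hm : MemLp (toQuotFun (adelicGroupData (↥(maximalRealSubfield L)) L (IsCMField.complexConj L) 3 H) fun x => Φ x j) 2 μ,
      (((v j : P.archModuleCM ι T hT) : P.space.toSubmodule) : (adelicGroupData (↥(maximalRealSubfield L)) L (IsCMField.complexConj L) 3 H).L2 μ) =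
        hm.toLp _ := fun j => ⟨_, hv j⟩
  obtain ⟨U, hU⟩ : ∃ U : Submodule ℂ (P.archModuleCM ι T hT), U = gen (P.archRepLieCM ι T hT) Complex.I (Submodule.span ℂ (Set.range v)) :=
    ⟨_, rfl⟩
  have hK : ∀ k : (uFormGroup (Fin 2) (Fin 1)).maximalCompact, U ≤ U.comap (P.archRepKCM ι T hT k) :=
    hU ▸ gen_le_comap_archRepKCM ι T hT hdef h2 μ P hΦ v hv'
  have h𝔤 : ∀ X : (uFormGroup (Fin 2) (Fin 1)).lie, U ≤ U.comap (P.archRepLieCM ι T hT X) :=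
    hU ▸ gen_le_comap_archRepLieCM ι T hT hdef h2 μ P hΦ v hv'
  have hcoh := isCohUnitaryIrrep_gen_cm ι T hT hdef h2 μ P hΦ v hv' hΦ0 U hU hK h𝔤
  have htyp := upqTypeClasses_gen_ne_bot_cm ι T hT hdef h2 μ P hΦ v hv' hΦ0 U hU hK h𝔤
  have hMU := areGKEquivalent_token_gen_cm ι T hT hdef h2 μ P hΦ v hv' hΦ0 hPΦ U hU hK h𝔤 hirr T₁ hT₁K hT₁𝔤 hT₁
  have hUW := stub_T6c_degOneTypeRigid (↥U) _ _ hcoh W ρK ρ𝔤 hW 1 (Or.inl rfl) htyp hWt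
  exact hMU.trans' hUW

include hdef h2 in
/-- **Existence of a UNITARY token**: a holomorphic-type `P` (compact CM datum) has a token `(M, σK, σ𝔤)` that is `IsCohUnitaryIrrep` with a
non-zero type-`(+1)` class — namely `gen(Φ)`, reached from `P.archModuleCM ι T hT` by transporting ★ K4's token map along the equivalence
`areGKEquivalent_token_gen_cm`. [cite: Rogawski1990, Prop. 15.2.1 (b)] [cite: BorelWallach2000, VI Thm. 4.11] -/
theorem exists_cohUnitaryIrrep_token_of_isHolCotangentAt_cpt
    (hP : P.IsHolCotangentAt (cmArchSection L ι H T hT) (cmCompactFactor L ι H T hT)) :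
    ∃ (M : Type) (_ : AddCommGroup M) (_ : Module ℂ M) (σK : Representation ℂ (uFormGroup (Fin 2) (Fin 1)).maximalCompact M)
      (σ𝔤 : (uFormGroup (Fin 2) (Fin 1)).lie →ₗ⁅ℝ⁆ Module.End ℂ M) (hM : IsCohUnitaryIrrep σK σ𝔤),
      (∃ T₁ : P.archModuleCM ι T hT →ₗ[ℂ] M,
        (∀ (k : (uFormGroup (Fin 2) (Fin 1)).maximalCompact) (w : P.archModuleCM ι T hT),
            T₁ (P.archRepKCM ι T hT k w) = σK k (T₁ w)) ∧
          (∀ (X : (uFormGroup (Fin 2) (Fin 1)).lie) (w : P.archModuleCM ι T hT),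
            T₁ (P.archRepLieCM ι T hT X w) = σ𝔤 X (T₁ w)) ∧ T₁ ≠ 0) ∧
      upqTypeClasses σK σ𝔤 hM.gk.ad_compat 1 1 ≠ ⊥ := by
  haveI := compactSpace_automorphicQuotient_cm hdef h2 (L := L) (ι := ι) (H := H)
  have htok := exists_cohToken_of_isHolCotangentAt_cpt L ι H T hT μ hdef h2 P hP
  obtain ⟨M₀, i₁, i₂, σK₀, σ𝔤₀, hM₀, hirr₀, ⟨T₀, hT₀K, hT₀𝔤, hT₀⟩, -⟩ := htok
  obtain ⟨Φ, hΦ, hΦ0, hPΦ⟩ := hP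
  have hPj : ∀ j : Fin 2, (memLp_toQuotFun_apply ι T hT (μ := μ) hΦ j).toLp _ ∈ P.space.toSubmodule :=
    fun j => (hPΦ j).elim fun _ h => h
  have hvex := exists_vectors ι T hT P hΦ hPj
  obtain ⟨v, hv⟩ := hvex
  have hv' : ∀ j : Fin 2, ∃ hm : MemLp (toQuotFun (adelicGroupData (↥(maximalRealSubfield L)) L (IsCMField.complexConj L) 3 H) fun x => Φ x j) 2 μ,
      (((v j : P.archModuleCM ι T hT) : P.space.toSubmodule) : (adelicGroupData (↥(maximalRealSubfield L)) L (IsCMField.complexConj L) 3 H).L2 μ) =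
        hm.toLp _ := fun j => ⟨_, hv j⟩
  -- an OPAQUE name for `gen(Φ)` (never unfolded below)
  obtain ⟨U, hU⟩ : ∃ U : Submodule ℂ (P.archModuleCM ι T hT), U = gen (P.archRepLieCM ι T hT) Complex.I (Submodule.span ℂ (Set.range v)) :=
    ⟨_, rfl⟩
  have hK : ∀ k : (uFormGroup (Fin 2) (Fin 1)).maximalCompact, U ≤ U.comap (P.archRepKCM ι T hT k) :=
    hU ▸ gen_le_comap_archRepKCM ι T hT hdef h2 μ P hΦ v hv'
  have h𝔤 : ∀ X : (uFormGroup (Fin 2) (Fin 1)).lie, U ≤ U.comap (P.archRepLieCM ι T hT X) :=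
    hU ▸ gen_le_comap_archRepLieCM ι T hT hdef h2 μ P hΦ v hv'
  have hcoh := isCohUnitaryIrrep_gen_cm ι T hT hdef h2 μ P hΦ v hv' hΦ0 U hU hK h𝔤
  have htyp := upqTypeClasses_gen_ne_bot_cm ι T hT hdef h2 μ P hΦ v hv' hΦ0 U hU hK h𝔤
  have heqv := areGKEquivalent_token_gen_cm ι T hT hdef h2 μ P hΦ v hv' hΦ0 hPΦ U hU hK h𝔤 hirr₀ T₀ hT₀K hT₀𝔤 hT₀
  obtain ⟨e⟩ := heqv
  -- the transported token map and its three properties, stated at `↥U` before packing the existential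
  have hTK : ∀ (k : (uFormGroup (Fin 2) (Fin 1)).maximalCompact) (w : P.archModuleCM ι T hT),
      (e.toLinearEquiv.toLinearMap ∘ₗ T₀) (P.archRepKCM ι T hT k w) =
        (P.archRepKCM ι T hT).subrepresentation U hK k ((e.toLinearEquiv.toLinearMap ∘ₗ T₀) w) := fun k w => by
    simp only [LinearMap.comp_apply, LinearEquiv.coe_toLinearMap]
    rw [hT₀K]
    exact e.map_ρK k (T₀ w)
  have hT𝔤 : ∀ (X : (uFormGroup (Fin 2) (Fin 1)).lie) (w : P.archModuleCM ι T hT),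
      (e.toLinearEquiv.toLinearMap ∘ₗ T₀) (P.archRepLieCM ι T hT X w) =
        GKSubmodule.subLie (uFormGroup (Fin 2) (Fin 1)) (P.archRepLieCM ι T hT) U h𝔤 X ((e.toLinearEquiv.toLinearMap ∘ₗ T₀) w) :=
    fun X w => (congrArg e.toLinearEquiv (hT₀𝔤 X w)).trans (e.map_ρ𝔤 X (T₀ w))
  have hTne : e.toLinearEquiv.toLinearMap ∘ₗ T₀ ≠ 0 := by
    intro h0
    apply hT₀
    ext w
    have h := LinearMap.congr_fun h0 w
    simp only [LinearMap.comp_apply, LinearMap.zero_apply, LinearEquiv.coe_toLinearMap, LinearEquiv.map_eq_zero_iff] at h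
    rw [h, LinearMap.zero_apply]
  exact ⟨↥U, inferInstance, inferInstance, (P.archRepKCM ι T hT).subrepresentation U hK,
    GKSubmodule.subLie (uFormGroup (Fin 2) (Fin 1)) (P.archRepLieCM ι T hT) U h𝔤, hcoh, ⟨_, hTK, hT𝔤, hTne⟩, htyp⟩


end Summit.HodgeConjecture.HodgeConjecture.Cruxes.H413.F0P3ArchTokenUnitary

end
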